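import Mathlib.AlgebraicGeometry.Morphisms.QuasiCompact
import Literature.AlgebraicGeometry.Morphisms.ProductAffineCover
import Literature.AlgebraicGeometry.AbelianSchemes.AbelianSchemeQuotientMulNDescent
import HarnessLib

/-!
# Finite affine subcovers and the DIAGONAL COVER `(V_i ∩ V_j ∩ g⁻¹ V_l)` of a separated `k`-scheme (Čech bookkeeping for `[2]^*`)

Layer `Literature/AlgebraicGeometry/AbelianSchemes` (THEOREMS only — no definition, no instance, no notation, no named
fact); cell `hodgecm-mathlib`, F-11 sub-line P1b, MONO-G1 slot (5) `hrel₃` («`[2]^* = 4` on `Ȟ²(𝒪)`», road N1–N4 of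
F0P1b-p01 (g2) ∕ F0P1b-p04 (g2)): steps (S2)–(S3) of the N4 assembly, shed to B-p19 (g19) by F0P1b-plan (g2) (R123)(c).
The covers are CHARACTERISED by their shapes (as in the sibling ★ `Morphisms/ProductAffineCover`, whose `exists_tripleCover`
is the model); consumers `obtain` them once.

For a `k`-scheme `Z → Spec k` which is SEPARATED, a family of affine opens `V : ι → Z.affineOpens` and an endomorphism
`g : Z → Z` (for an abelian variety `B`: `g = [2]_B`):
* §1 `exists_fin_subcover_of_compactSpace` — a cover of a quasi-compact scheme by opens has a finite subcover REINDEXED BY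
  `Fin n` (`e : Fin n → ι`, `⨆ i, U (e i) = ⊤`; the linear order of `Fin n` is what the ordered Čech dialect ★
  `Algebra/Homology/OrderedCechSystem*` wants); `AbelianSchemeOver.exists_fin_affine_subcover` — the case of an abelian
  scheme over an affine base (proper, hence quasi-compact over the quasi-compact `Spec k`);
* §2 `isAffineOpen_inf_inf_preimage` — `V_i ∩ V_j ∩ g⁻¹ V_l` is AFFINE (twice ★ `isAffineOpen_inf_preimage`: an affine open
  met with the preimage of an affine open along a map to a separated `k`-scheme is affine); **`exists_diagonalCover`** —
  `∃ W : (ι ×ₗ ι) ×ₗ ι → Z.affineOpens, (W ((i, j), l)).1 = V_i ⊓ V_j ⊓ g⁻¹ V_l`; `diagonalCover_eq` (read on a general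
  index); **`iSup_diagonalCover_eq_top`** (it covers when `V` covers: `z ∈ V_i`, `g z ∈ V_l` ⇒ `z ∈ W ((i, i), l)`);
  the ADMISSIBILITY `W d ⊆ f⁻¹ V (θ d)` of the three index maps `θ₁ ((i, j), l) = i`, `θ₂ ((i, j), l) = j` (along `𝟙`) and
  `θ₃ ((i, j), l) = l` (along `g`) — the binder `hθ` of ★ `Modules/CechPullbackSystemHom.pullbackSystemHom` —, and the
  monotonicity of `θ₁`;
* §3 `AbelianSchemeOver.exists_diagonalCover_mulN` ∕ `…_of_cover` — the instantiation `Z := B.X`, `g := (B.mulN n).left` for an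
  abelian scheme `B` over `Spec k` (separated because proper — Mathlib's instance from `B.isProper`; cf. ★
  `AbelianSchemeOver.isSeparated_hom`): the cover on which `[n]^*` and the two restrictions to `V_i`,
  `V_j` are read SIMULTANEOUSLY (for `n = 2`: `[2] = m ∘ Δ`, so `Δ⁻¹ (p₁⁻¹ V_i ∩ p₂⁻¹ V_j ∩ m⁻¹ V_l) = V_i ∩ V_j ∩ [2]⁻¹ V_l`
  is the pull-back of the triple cover of ★ `ProductAffineCover` along the diagonal — the Čech side of [MumfordAV1970] §13's
  computation of `[n]^*` on `H•(A, 𝒪)` from `m^* = p₁^* + p₂^*` in degree one).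

HC_CM is proved only modulo the 7 printed citations until rung 0 closes — nothing here bears on a summit statement.

## References
* [Hartshorne1977] R. Hartshorne, *Algebraic Geometry*, GTM 52 (1977): II Ex. 4.3 (intersections of affine opens in a
  separated scheme are affine), III §4 (Čech cohomology; refinement along index maps, p. 218 ff.).
* [GortzWedhorn2020] U. Görtz, T. Wedhorn, *Algebraic Geometry I*, 2nd ed. (2020): Prop. 9.15 (p. 235) and Prop. 12.3
  (p. 325) (separated and affine morphisms), Prop. 3.5 (preimages), Def. 1.22 (p. 14) (quasi-compact), Def. 12.55 (p. 348)
  and Def. 10.5 (p. 246) (proper ⇒ of finite type ⇒ quasi-compact).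
* [StacksProject] The Stacks Project, Tag 01FG (Čech complex and refinements), Tag 01SG (affine morphisms), Tag 01KP
  (separated: intersections of affines).
* [MumfordAV1970] D. Mumford, *Abelian Varieties* (1970), §13 (the cohomology ring `H•(A, 𝒪)`, `[n]^*`).
-/

universe u

open CategoryTheory AlgebraicGeometry TopologicalSpace Opposite

namespace Literature.AlgebraicGeometry.AbelianSchemes

open Literature.AlgebraicGeometry.Morphisms

/-! ## §1 Finite subcovers reindexed by `Fin n` -/

/-- **A cover of a quasi-compact scheme by opens has a finite subcover reindexed by `Fin n`**: `⨆ j, U j = ⊤` on a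
`CompactSpace` gives `e : Fin n → ι` with `⨆ i, U (e i) = ⊤` (Mathlib `IsCompact.elim_finite_subcover` on `univ`, then
`Finset.equivFin`). [cite: GortzWedhorn2020, Def. 1.22 (p. 14) (quasi-compact: every open covering has a finite subcovering)] -/
theorem exists_fin_subcover_of_compactSpace {X : Scheme.{u}} [CompactSpace X] {ι : Type*} (U : ι → X.Opens)
    (hU : ⨆ j, U j = ⊤) : ∃ (n : ℕ) (e : Fin n → ι), ⨆ i, U (e i) = ⊤ := by
  classical
  obtain ⟨t, ht⟩ := isCompact_univ.elim_finite_subcover (fun j => (U j : Set X)) (fun j => (U j).isOpen)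
    (by rw [← Opens.coe_iSup, hU, Opens.coe_top])
  refine ⟨t.card, fun i => (t.equivFin.symm i).1, top_le_iff.mp fun x _ => ?_⟩
  obtain ⟨j, hj, hx⟩ := Set.mem_iUnion₂.mp (ht (Set.mem_univ x))
  exact Opens.mem_iSup.mpr ⟨t.equivFin ⟨j, hj⟩, by simpa using hx⟩

/-- **An abelian scheme over an affine base has, in every affine open cover, a finite subcover reindexed by `Fin n`**:
`B.X → Spec k` is proper, hence quasi-compact, and `Spec k` is quasi-compact, so the underlying space of `B.X` is compact
(Mathlib `QuasiCompact.compactSpace_of_compactSpace`). [cite: GortzWedhorn2020, Def. 12.55 (p. 348) and Def. 10.5 (p. 246) (proper ⇒ of finite type ⇒ quasi-compact)] -/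
theorem AbelianSchemeOver.exists_fin_affine_subcover {k : Type u} [CommRing k] (B : AbelianSchemeOver (Spec (.of k)))
    {ι : Type*} (U : ι → B.X.left.affineOpens) (hU : ⨆ j, (U j).1 = ⊤) :
    ∃ (n : ℕ) (e : Fin n → ι), ⨆ i, (U (e i)).1 = ⊤ := by
  haveI : IsProper B.X.hom := B.isProper
  haveI : CompactSpace B.X.left := QuasiCompact.compactSpace_of_compactSpace B.X.hom
  exact exists_fin_subcover_of_compactSpace (fun j => (U j).1) hU

/-! ## §2 The diagonal cover `W ((i, j), l) = V_i ∩ V_j ∩ g⁻¹ V_l` of a separated `k`-scheme -/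

section Diagonal

variable {k : Type u} [CommRing k] {Z : Over (Spec (CommRingCat.of k))}
  {ι : Type} (V : ι → Z.left.affineOpens) (g : Z.left ⟶ Z.left)

/-- **`V_i ∩ V_j ∩ g⁻¹ V_l` is an affine open** of a `k`-scheme `Z` SEPARATED over `Spec k`, for affine opens `V_i`, `V_j`,
`V_l` and any endomorphism `g` (★ `isAffineOpen_inf_preimage` along `𝟙` and along `g`).
[cite: Hartshorne1977, II Ex. 4.3] [cite: GortzWedhorn2020, Prop. 12.3 (p. 325) and Prop. 9.15 (p. 235)] -/
theorem isAffineOpen_inf_inf_preimage [IsSeparated Z.hom] (i j l : ι) :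
    IsAffineOpen ((V i).1 ⊓ (V j).1 ⊓ g ⁻¹ᵁ (V l).1) :=
  isAffineOpen_inf_preimage g (isAffineOpen_inf_preimage (𝟙 Z.left) (V i).2 (V j)) (V l)

/-- **THE DIAGONAL COVER exists**: affine opens `W ((i, j), l) = V_i ∩ V_j ∩ g⁻¹ V_l` indexed by `(ι ×ₗ ι) ×ₗ ι`
(for `Z = B` an abelian variety and `g = [2]_B`: the cover on which `[2]^*` and the restrictions to `V_i`, `V_j` are read).
[cite: StacksProject, Tag 01FG] [cite: Hartshorne1977, III §4 (p. 218)] -/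
theorem exists_diagonalCover [IsSeparated Z.hom] :
    ∃ W : (ι ×ₗ ι) ×ₗ ι → Z.left.affineOpens,
      ∀ i j l, (W (toLex (toLex (i, j), l))).1 = (V i).1 ⊓ (V j).1 ⊓ g ⁻¹ᵁ (V l).1 :=
  ⟨fun d => ⟨_, isAffineOpen_inf_inf_preimage V g (ofLex (ofLex d).1).1 (ofLex (ofLex d).1).2 (ofLex d).2⟩,
    fun _ _ _ => rfl⟩

variable (W : (ι ×ₗ ι) ×ₗ ι → Z.left.affineOpens)
  (hW : ∀ i j l, (W (toLex (toLex (i, j), l))).1 = (V i).1 ⊓ (V j).1 ⊓ g ⁻¹ᵁ (V l).1)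

include hW in
/-- The diagonal cover read on a general index `d`: `W d = V_{d.1.1} ∩ V_{d.1.2} ∩ g⁻¹ V_{d.2}`.
[cite: StacksProject, Tag 01FG] -/
theorem diagonalCover_eq (d : (ι ×ₗ ι) ×ₗ ι) :
    (W d).1 = (V (ofLex (ofLex d).1).1).1 ⊓ (V (ofLex (ofLex d).1).2).1 ⊓ g ⁻¹ᵁ (V (ofLex d).2).1 := by
  rw [← hW]
  rfl

include hW in
/-- **The diagonal cover COVERS** when `V` covers `Z`: a point `z ∈ V_i` with `g z ∈ V_l` lies in `W ((i, i), l)`.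
[cite: StacksProject, Tag 01FG] [cite: Hartshorne1977, III §4 (p. 218)] -/
theorem iSup_diagonalCover_eq_top (hV : ⨆ j, (V j).1 = ⊤) : ⨆ d, (W d).1 = ⊤ := by
  refine top_le_iff.mp fun z _ => ?_
  have hz₁ : z ∈ (⊤ : Z.left.Opens) := trivial
  have hz₂ : g z ∈ (⊤ : Z.left.Opens) := trivial
  rw [← hV] at hz₁ hz₂
  obtain ⟨i, hi⟩ := Opens.mem_iSup.mp hz₁
  obtain ⟨l, hl⟩ := Opens.mem_iSup.mp hz₂
  exact Opens.mem_iSup.mpr ⟨toLex (toLex (i, i), l), by rw [hW]; exact ⟨⟨hi, hi⟩, hl⟩⟩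

include hW in
/-- **`θ₁ ((i, j), l) = i` is admissible** (along the identity): `W ((i, j), l) ⊆ V_i` — the binder `hθ` of ★
`Modules.pullbackSystemHom (𝟙 Z) V W θ₁`. [cite: Hartshorne1977, III §4 (p. 218)] [cite: StacksProject, Tag 01FG] -/
theorem diagonalCover_le_fst (d : (ι ×ₗ ι) ×ₗ ι) : (W d).1 ≤ (𝟙 Z.left) ⁻¹ᵁ (V (ofLex (ofLex d).1).1).1 := by
  rw [diagonalCover_eq V g W hW d]
  exact inf_le_left.trans inf_le_left

include hW in
/-- **`θ₂ ((i, j), l) = j` is admissible** (along the identity): `W ((i, j), l) ⊆ V_j`.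
[cite: Hartshorne1977, III §4 (p. 218)] [cite: StacksProject, Tag 01FG] -/
theorem diagonalCover_le_snd (d : (ι ×ₗ ι) ×ₗ ι) : (W d).1 ≤ (𝟙 Z.left) ⁻¹ᵁ (V (ofLex (ofLex d).1).2).1 := by
  rw [diagonalCover_eq V g W hW d]
  exact inf_le_left.trans inf_le_right

include hW in
/-- **`θ₃ ((i, j), l) = l` is admissible along `g`**: `W ((i, j), l) ⊆ g⁻¹ V_l` — the binder `hθ` of ★
`Modules.pullbackSystemHom g V W θ₃`. [cite: Hartshorne1977, III §4 (p. 218)] [cite: StacksProject, Tag 01FG] -/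
theorem diagonalCover_le_preimage (d : (ι ×ₗ ι) ×ₗ ι) : (W d).1 ≤ g ⁻¹ᵁ (V (ofLex d).2).1 := by
  rw [diagonalCover_eq V g W hW d]
  exact inf_le_right

include hW in
/-- The diagonal cover refines `V` plainly (no preimage sign): `W d ⊆ V_{θ₁ d}` — the form wanted when the refinement is
read on cochains of ONE scheme (★ `OrderedCech.refineCochain`). [cite: StacksProject, Tag 01FG] -/
theorem diagonalCover_le (d : (ι ×ₗ ι) ×ₗ ι) : (W d).1 ≤ (V (ofLex (ofLex d).1).1).1 :=
  diagonalCover_le_fst V g W hW d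

omit hW in
/-- `θ₁ = fst ∘ ofLex ∘ fst ∘ ofLex` is monotone for the lexicographic orders (a MONOTONE refinement map, as the ordered
Čech refinement ★ `OrderedCech.refineCochain` prefers). [cite: Hartshorne1977, III §4 (p. 218)] -/
theorem monotone_diagonalIndexMap_fst [Preorder ι] :
    Monotone fun d : (ι ×ₗ ι) ×ₗ ι => (ofLex (ofLex d).1).1 :=
  Prod.Lex.monotone_fst_ofLex.comp Prod.Lex.monotone_fst_ofLex

end Diagonal

/-! ## §3 The diagonal cover of an abelian scheme over `Spec k` along `[n]` -/

namespace AbelianSchemeOver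

variable {k : Type u} [CommRing k] (B : AbelianSchemeOver (Spec (CommRingCat.of k))) {ι : Type}
  (V : ι → B.X.left.affineOpens)

/-- **THE DIAGONAL COVER OF AN ABELIAN SCHEME ALONG `[n]`**: for affine opens `V_i ⊆ B` there are affine opens
`WΔ ((i, j), l) = V_i ∩ V_j ∩ [n]⁻¹ V_l` indexed by `(ι ×ₗ ι) ×ₗ ι` (`[n] = (B.mulN n).left`; `n = 2` for the `hrel₃`
road). [cite: MumfordAV1970, §13 (p. 125)] [cite: StacksProject, Tag 01FG] -/
theorem exists_diagonalCover_mulN (n : ℕ) :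
    ∃ WΔ : (ι ×ₗ ι) ×ₗ ι → B.X.left.affineOpens,
      ∀ i j l, (WΔ (toLex (toLex (i, j), l))).1 = (V i).1 ⊓ (V j).1 ⊓ (B.mulN n).left ⁻¹ᵁ (V l).1 := by
  haveI : IsProper B.X.hom := B.isProper
  exact exists_diagonalCover V (B.mulN n).left

/-- **The diagonal cover of an abelian scheme along `[n]`, WITH ITS COVERING PROPERTY** when `V` covers `B`.
[cite: MumfordAV1970, §13 (p. 125)] [cite: StacksProject, Tag 01FG] -/
theorem exists_diagonalCover_mulN_of_cover (hV : ⨆ j, (V j).1 = ⊤) (n : ℕ) :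
    ∃ WΔ : (ι ×ₗ ι) ×ₗ ι → B.X.left.affineOpens,
      (∀ i j l, (WΔ (toLex (toLex (i, j), l))).1 = (V i).1 ⊓ (V j).1 ⊓ (B.mulN n).left ⁻¹ᵁ (V l).1) ∧
        ⨆ d, (WΔ d).1 = ⊤ := by
  obtain ⟨WΔ, hWΔ⟩ := B.exists_diagonalCover_mulN V n
  exact ⟨WΔ, hWΔ, iSup_diagonalCover_eq_top V (B.mulN n).left WΔ hWΔ hV⟩

/-- **(S2)–(S3) of the N4 assembly in one call**: an affine open cover `U : ι → B.affineOpens` of an abelian scheme over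
`Spec k` has a finite subcover `V = U ∘ e` (`e : Fin m → ι`) and, for it, the diagonal cover
`WΔ : (Fin m ×ₗ Fin m) ×ₗ Fin m → B.affineOpens`, `WΔ ((i, j), l) = V_i ∩ V_j ∩ [n]⁻¹ V_l`, which covers `B`.
[cite: MumfordAV1970, §13 (p. 125)] [cite: StacksProject, Tag 01FG] -/
theorem exists_fin_subcover_diagonalCover_mulN (U : ι → B.X.left.affineOpens) (hU : ⨆ j, (U j).1 = ⊤) (n : ℕ) :
    ∃ (m : ℕ) (e : Fin m → ι) (_ : ⨆ i, (U (e i)).1 = ⊤)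
      (WΔ : (Fin m ×ₗ Fin m) ×ₗ Fin m → B.X.left.affineOpens),
      (∀ i j l, (WΔ (toLex (toLex (i, j), l))).1 = (U (e i)).1 ⊓ (U (e j)).1 ⊓ (B.mulN n).left ⁻¹ᵁ (U (e l)).1) ∧
        ⨆ d, (WΔ d).1 = ⊤ := by
  obtain ⟨m, e, he⟩ := B.exists_fin_affine_subcover U hU
  obtain ⟨WΔ, hWΔ, hcov⟩ := B.exists_diagonalCover_mulN_of_cover (fun i => U (e i)) he n
  exact ⟨m, e, he, WΔ, hWΔ, hcov⟩

end AbelianSchemeOver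

end Literature.AlgebraicGeometry.AbelianSchemes
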